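import Literature.AlgebraicGeometry.HodgeTheory.LefschetzGroupEndInvariantsCentre
import Literature.AlgebraicGeometry.HodgeTheory.WeilClassesFieldHodgeSemisimpleHodgeGroup
import Literature.AlgebraicGeometry.HodgeTheory.CMTypeIffCentralizerCommutative
import HarnessLib

/-!
# `Z(G_div(X)) = U_{K_B}` and `Z(Hdg) ⊂ U_E`, with `G_div` read as Milne's `S(A)(h)(ℂ)`
# (Moonen–Zarhin 1998, §1 Lemma (1) and the Remark (1) after Criterion (2))

Layer `Literature/AlgebraicGeometry/HodgeTheory`; THEOREMS ONLY (no definition, no named fact; D-0026 net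
debt 0). Sequel of `LefschetzGroupEndInvariantsCentre` (Lemma (3) first clause and Lemma (1), inclusion
`Z(S(A)(h)(ℂ)) ⊂ Z(End⁰ A) ⊗ ℂ` and finiteness for types 1–3) and of `HodgeGroupSemisimpleOfNoTypeIVFactor`.

## The print

B. J. J. Moonen, Yu. G. Zarhin, *Weil classes on abelian varieties*, J. reine angew. Math. **496** (1998) =
arXiv:alg-geom/9612017 [MoonenZarhin1998WeilClasses] (held text `paper:arxiv-alg-geom_9612017`), VERBATIM:

> §1 Lemma (chunk p0002): «(1) The center of `G_div(X)` is the group `U_{K_B}` given by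
> `U_{K_B}(R) = {a ∈ (K_B ⊗_ℚ R)^* | a a† = 1}`.»
> Remark (1) after Criterion (2) (chunk p0004): «let us recall that the center `Z(Hdg)` of the Hodge group is
> contained in the torus `U_E`, and that the action of `Hdg` on `W_F` is given by the `F`-linear determinant.»

Here `K_B = Z(B)`, and `B = End⁰(X)` in the cases «`m ≥ 2` or type 1 or 2» of Table 1, so `K_B = E = Z(End⁰ X)`
and `G_div(X) := Gl_B(V) ∩ Sp(V, φ)` is the centralizer of `End⁰(X)` in `Sp(V, φ)` — Milne's `S(A)` (as in the
seat's `WeilClassesFieldDecomposableIffLefschetzGroup` and `LefschetzGroupEndInvariantsCentre`); in the remaining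
cases (type 3 with `m = 1`, type 4 with `d = m = 1`, where `B ⊊ End⁰(X)`) Milne's `S(A)(h)(ℂ)` is only a subgroup
of `G_div(X)(ℂ)`, and everything below is stated and proved for `S(A)(h)(ℂ)`.

## What is proved (carrier `H¹(A(ℂ); ℂ)`, `G_div := S(A)(h)(ℂ) = Milne1999.unitaryCentralizerGroup A h`)

`(K_B ⊗ ℂ)`-on-`H¹` is read as the `ℂ`-span of the CENTRAL pull-backs `u^*` (`u ∈ End(A)` with
`u^* ∈ C(A) ⊗ ℂ`), and `a a† = 1` as «`a` preserves the polarization pairing `Q_h`».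

* §1 **Lemma (1), `⊇`**: an element of `S(A)(h)(ℂ)` whose underlying endomorphism is a `ℂ`-combination of
  pull-backs is central (`mem_center_unitaryCentralizerGroup_of_coe_mem_span_pullbackOne`; no hypothesis on `h`).
* §2 **Lemma (1) as an equivalence**, for `h ∈ B¹(A) ⊗ ℂ`: `z ∈ Z(S(A)(h)(ℂ))` iff `z` is a `ℂ`-combination
  of pull-backs, iff `z` is a `ℂ`-combination of central pull-backs
  (`mem_center_unitaryCentralizerGroup_iff_coe_mem_span_pullbackOne`,
  `mem_center_unitaryCentralizerGroup_iff_coe_mem_span_central_pullbackOne`), and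
  **`Z(G_div(X)) = U_{K_B}`**: an automorphism `u` of `H¹(A(ℂ); ℂ)` is a central element of `S(A)(h)(ℂ)` iff
  `u ∈ span{central pull-backs}` and `u` preserves `Q_h` (`exists_mem_center_unitaryCentralizerGroup_iff`).
* §3 **«`Z(Hdg) ⊂ U_E`»**: a central element of `Hg(A)(ℂ)|_{H¹}` is a `ℂ`-combination of central pull-backs
  (the tree's `coe_mem_span_central_pullbackOne_of_mem_center_hodgeGroupOne`,
  `WeilClassesFieldHodgeSemisimpleHodgeGroup` §1, consumed by name) and is CENTRAL in
  `S(A)(h)(ℂ) ⊇ Hg(A)(ℂ)|_{H¹}` (`mem_center_unitaryCentralizerGroup_of_mem_center_hodgeGroupOne`,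
  `map_center_hodgeGroupOne_le_map_center_unitaryCentralizerGroup`); so for `A` without factors of type IV
  the finiteness of `Z(Hg(A)(ℂ)|_{H¹})` (the tree's `HodgeGroupSemisimple.finite_center_hodgeGroupOne`, not
  restated here) is also a consequence of the finiteness of `Z(S(A)(h)(ℂ))` (`finite_center_unitaryCentralizerGroup`).

* §4 **`Z(G_div(X)) = G_div(X)` iff `X` is of CM-type** (the torus case `U_E = G_div`: Milne 1999b Rem. 1.10
  «`C₀(A) ⊗_ℚ Q → C(A)` is an isomorphism … `π(A)` is commutative» for `A` with many endomorphisms, and Deligne I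
  §5 «of CM-type if its Mumford–Tate group is commutative»; the tree's `isOfCMType_iff_centralizerAlgebra_comm`):
  for `h ∈ B¹(A) ⊗ ℂ`, `S(A)(h)(ℂ)` is commutative iff `A` is of CM-type (`unitaryCentralizerGroup_comm_iff_isOfCMType`,
  `center_unitaryCentralizerGroup_eq_top_iff_isOfCMType`): `⟸` since `S(A)(h)(ℂ) ≤ (C(A) ⊗ ℂ)^×` with `C(A)`
  commutative, `⟹` since `Hg(A)(ℂ)|_{H¹} ≤ S(A)(h)(ℂ)` and an element of `Hg(A)(ℂ)` is determined by its degree-one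
  component (`hodgeGroup_ext_one`).

NOT here: `U_{K_B}` / `U_E` as algebraic tori, connectedness, ranks (no algebraic-group structure on the
Tannaka-free carriers); the `F`-linear determinant sentence is the seat's `WeilClassesFieldFLinear` /
`WeilClassesFieldLefschetzGroup` (by name).

## References

* [MoonenZarhin1998WeilClasses] B. J. J. Moonen, Yu. G. Zarhin, *Weil classes on abelian varieties*,
  J. reine angew. Math. 496 (1998) = arXiv:alg-geom/9612017, §1 Lemma (1) (chunk p0002); Remark (1) after
  Criterion (2) (chunk p0004).
* [Milne1999LefschetzClasses] J. S. Milne, *Lefschetz classes on abelian varieties*, Duke Math. J. 96 (1999),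
  §1 p. 644 (`S(A)`).
* [Deligne1982HodgeCycles] P. Deligne, *Hodge cycles on abelian varieties*, LNM 900 (1982), I Prop. 3.4; I §5
  (CM-type = commutative Mumford–Tate group).
* [Milne1999] J. S. Milne, *Lefschetz motives and the Tate conjecture*, Compositio Math. 117 (1999), §1 Rem. 1.10
  (p. 53) — the tree's `isOfCMType_iff_centralizerAlgebra_comm`.

## Provenance

Lane `lit-hodgefound` (Track 2, Layer A), prover seat `lit-hodgefound-p21` (generation 13), row g13-#3; sequel of
g13-#2 (`LefschetzGroupEndInvariantsCentre`).
-/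

noncomputable section

namespace Literature.AlgebraicGeometry.HodgeTheory

open CategoryTheory
open Literature.AlgebraicTopology.SingularHomology
open Literature.AlgebraicGeometry.Motives
open Literature.AlgebraicGeometry.VanGeemen1994 (pullbackOne hodgeGroupOne mem_hodgeGroupOne_iff hodgeClassSpan)
open Literature.AlgebraicGeometry.Milne1999 (IsOfCMType centralizerAlgebra centralizerGroup unitaryCentralizerGroup
  mem_centralizerGroup_iff mem_centralizerGroup_iff_coe_mem hodgeGroupOne_le_unitaryCentralizerGroup
  hodgeGroupOne_le_centralizerGroup unitaryCentralizerGroup_le_centralizerGroup)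
open Literature.Geometry.Kaehler (HasHardLefschetzProperty)

variable {A : AbelianVariety ℂ} {h : complexBetti A.X 2}

/-! ### §1 `U_{K_B} ⊆ Z(G_div)`: pull-back combinations inside `S(A)(h)(ℂ)` are central -/

/-- The span of the central pull-backs is contained in the span of all pull-backs. [folklore] -/
private theorem span_central_pullbackOne_le_span_pullbackOne :
    Submodule.span ℂ {Y : Module.End ℂ (complexBetti A.X 1) |
        ∃ u : A ⟶ A, Y = pullbackOne A u ∧ pullbackOne A u ∈ centralizerAlgebra A} ≤
      Submodule.span ℂ (Set.range fun φ : A ⟶ A ↦ pullbackOne A φ) :=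
  Submodule.span_mono fun _ ⟨u, hY, _⟩ ↦ ⟨u, hY.symm⟩

/-- The span of the central pull-backs is contained in `C(A) ⊗ ℂ` (a subalgebra containing its generators).
[cite: Milne1999LefschetzClasses, §1 p. 642] -/
theorem span_central_pullbackOne_le_centralizerAlgebra :
    Submodule.span ℂ {Y : Module.End ℂ (complexBetti A.X 1) |
        ∃ u : A ⟶ A, Y = pullbackOne A u ∧ pullbackOne A u ∈ centralizerAlgebra A} ≤
      Subalgebra.toSubmodule (centralizerAlgebra A) :=
  Submodule.span_le.2 fun _ ⟨_, hY, huC⟩ ↦ hY ▸ huC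

/-- **Moonen–Zarhin 1998, Lemma (1), inclusion `U_{K_B} ⊆ Z(G_div(X))`, with `G_div` read as `S(A)(h)(ℂ)`**: an element
of `S(A)(h)(ℂ)` whose underlying endomorphism of `H¹(A(ℂ); ℂ)` is a `ℂ`-combination of pull-backs `φ^*`
commutes with every element of `S(A)(h)(ℂ) ≤ (C(A) ⊗ ℂ)^×`, i.e. is central.
[cite: MoonenZarhin1998WeilClasses, §1 Lemma (1) (chunk p0002)] [cite: Milne1999LefschetzClasses, §1 p. 644] -/
theorem mem_center_unitaryCentralizerGroup_of_coe_mem_span_pullbackOne {z : unitaryCentralizerGroup A h}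
    (hz : ((z : complexBetti A.X 1 ≃ₗ[ℂ] complexBetti A.X 1) : Module.End ℂ (complexBetti A.X 1)) ∈
      Submodule.span ℂ (Set.range fun φ : A ⟶ A ↦ pullbackOne A φ)) :
    z ∈ Subgroup.center (unitaryCentralizerGroup A h) := by
  rw [Subgroup.mem_center_iff]
  intro u
  apply Subtype.ext
  rw [Subgroup.coe_mul, Subgroup.coe_mul]
  refine LinearEquiv.ext fun y ↦ ?_
  rw [LinearEquiv.mul_apply, LinearEquiv.mul_apply]
  exact (comm_of_mem_span_pullbackOne hz u.2 y).symm

/-! ### §2 Lemma (1) as an equivalence: `Z(G_div(X)) = U_{K_B}` -/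

/-- **Moonen–Zarhin 1998, Lemma (1) «The center of `G_div(X)` is the group `U_{K_B}`», with
`G_div` read as `S(A)(h)(ℂ)`, as an equivalence on the carrier**: for `h ∈ B¹(A) ⊗ ℂ`, an element of `S(A)(h)(ℂ)` is
central iff its underlying endomorphism of `H¹(A(ℂ); ℂ)` is a `ℂ`-combination of pull-backs `φ^*`
(`⟹`: `LefschetzGroupEndInvariantsCentre`, Deligne I 3.4; `⟸`: §1).
[cite: MoonenZarhin1998WeilClasses, §1 Lemma (1) (chunk p0002)] [cite: Deligne1982HodgeCycles, I §3, Prop. 3.4] -/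
theorem mem_center_unitaryCentralizerGroup_iff_coe_mem_span_pullbackOne (hh : h ∈ hodgeClassSpan A.dim A.X 1)
    {z : unitaryCentralizerGroup A h} :
    z ∈ Subgroup.center (unitaryCentralizerGroup A h) ↔
      ((z : complexBetti A.X 1 ≃ₗ[ℂ] complexBetti A.X 1) : Module.End ℂ (complexBetti A.X 1)) ∈
        Submodule.span ℂ (Set.range fun φ : A ⟶ A ↦ pullbackOne A φ) :=
  ⟨coe_mem_span_pullbackOne_of_mem_center_unitaryCentralizerGroup hh,
    mem_center_unitaryCentralizerGroup_of_coe_mem_span_pullbackOne⟩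

/-- **Lemma (1) as an equivalence, central pull-backs**: for `h ∈ B¹(A) ⊗ ℂ`, `z ∈ S(A)(h)(ℂ)` is central iff
its underlying endomorphism lies in the `ℂ`-span of the CENTRAL pull-backs `u^* ∈ C(A) ⊗ ℂ` — the carrier
reading of `Z(G_div) = U_{K_B} ⊂ (K_B ⊗ R)^*`, `K_B = Z(End⁰ X)`.
[cite: MoonenZarhin1998WeilClasses, §1 Lemma (1) (chunk p0002)] [cite: Deligne1982HodgeCycles, I §3, Prop. 3.4] -/
theorem mem_center_unitaryCentralizerGroup_iff_coe_mem_span_central_pullbackOne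
    (hh : h ∈ hodgeClassSpan A.dim A.X 1) {z : unitaryCentralizerGroup A h} :
    z ∈ Subgroup.center (unitaryCentralizerGroup A h) ↔
      ((z : complexBetti A.X 1 ≃ₗ[ℂ] complexBetti A.X 1) : Module.End ℂ (complexBetti A.X 1)) ∈
        Submodule.span ℂ {Y : Module.End ℂ (complexBetti A.X 1) |
          ∃ u : A ⟶ A, Y = pullbackOne A u ∧ pullbackOne A u ∈ centralizerAlgebra A} :=
  ⟨coe_mem_span_central_pullbackOne_of_mem_center_unitaryCentralizerGroup hh, fun hz ↦
    mem_center_unitaryCentralizerGroup_of_coe_mem_span_pullbackOne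
      (span_central_pullbackOne_le_span_pullbackOne hz)⟩

/-- **`Z(G_div(X)) = U_{K_B} = {a ∈ (K_B ⊗ R)^* | a a† = 1}` on the carrier** (`G_div` read as `S(A)(h)(ℂ)`,
`h ∈ B¹(A) ⊗ ℂ`): an automorphism `u` of `H¹(A(ℂ); ℂ)` belongs to `S(A)(h)(ℂ)` AND is central there iff `u` is a
`ℂ`-combination of central pull-backs (`a ∈ K_B ⊗ ℂ`) and preserves the polarization pairing `Q_h` (`a a† = 1`).
[cite: MoonenZarhin1998WeilClasses, §1 Lemma (1) (chunk p0002)] [cite: Milne1999LefschetzClasses, §1 p. 644] -/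
theorem exists_mem_center_unitaryCentralizerGroup_iff (hh : h ∈ hodgeClassSpan A.dim A.X 1)
    (u : complexBetti A.X 1 ≃ₗ[ℂ] complexBetti A.X 1) :
    (∃ hu : u ∈ unitaryCentralizerGroup A h, (⟨u, hu⟩ : unitaryCentralizerGroup A h) ∈
        Subgroup.center (unitaryCentralizerGroup A h)) ↔
      (u : Module.End ℂ (complexBetti A.X 1)) ∈
          Submodule.span ℂ {Y : Module.End ℂ (complexBetti A.X 1) |
            ∃ v : A ⟶ A, Y = pullbackOne A v ∧ pullbackOne A v ∈ centralizerAlgebra A} ∧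
        ∀ x y : complexBetti A.X 1,
          polarizationPairingOne A.X h (A.dim - 1) (u x) (u y) = polarizationPairingOne A.X h (A.dim - 1) x y := by
  constructor
  · rintro ⟨hu, hz⟩
    exact ⟨coe_mem_span_central_pullbackOne_of_mem_center_unitaryCentralizerGroup hh hz, hu.2⟩
  · rintro ⟨hspan, hQ⟩
    have huC : u ∈ centralizerGroup A :=
      mem_centralizerGroup_iff_coe_mem.2 (span_central_pullbackOne_le_centralizerAlgebra hspan)
    exact ⟨⟨huC, hQ⟩, mem_center_unitaryCentralizerGroup_of_coe_mem_span_pullbackOne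
      (span_central_pullbackOne_le_span_pullbackOne hspan)⟩

/-! ### §3 `Z(Hdg) ⊂ U_E`: the centre of the Hodge group is central in `S(A)(h)(ℂ)` -/

/-- A central element of `Hg(A)(ℂ)|_{H¹}` is a `ℂ`-combination of pull-backs `φ^*` (an element of
`End⁰(A) ⊗ ℂ` read on `H¹`). [cite: MoonenZarhin1998WeilClasses, Remark (1) after Criterion (2) (chunk p0004)]
[cite: Deligne1982HodgeCycles, I §3, Prop. 3.4] -/
theorem coe_mem_span_pullbackOne_of_mem_center_hodgeGroupOne {z : hodgeGroupOne A.dim A.X}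
    (hz : z ∈ Subgroup.center (hodgeGroupOne A.dim A.X)) :
    ((z : complexBetti A.X 1 ≃ₗ[ℂ] complexBetti A.X 1) : Module.End ℂ (complexBetti A.X 1)) ∈
      Submodule.span ℂ (Set.range fun φ : A ⟶ A ↦ pullbackOne A φ) :=
  span_central_pullbackOne_le_span_pullbackOne (coe_mem_span_central_pullbackOne_of_mem_center_hodgeGroupOne hz)

/-- **`Z(Hdg) ⊂ U_E = Z(G_div)` on the carrier**: for `h ∈ B¹(A) ⊗ ℂ` (so `Hg(A)(ℂ)|_{H¹} ≤ S(A)(h)(ℂ)`), a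
central element of `Hg(A)(ℂ)|_{H¹}` is a CENTRAL element of `S(A)(h)(ℂ)`.
[cite: MoonenZarhin1998WeilClasses, Remark (1) after Criterion (2) (chunk p0004) and §1 Lemma (1) (chunk p0002)] -/
theorem mem_center_unitaryCentralizerGroup_of_mem_center_hodgeGroupOne (hh : h ∈ hodgeClassSpan A.dim A.X 1)
    {z : hodgeGroupOne A.dim A.X} (hz : z ∈ Subgroup.center (hodgeGroupOne A.dim A.X)) :
    (⟨(z : complexBetti A.X 1 ≃ₗ[ℂ] complexBetti A.X 1), hodgeGroupOne_le_unitaryCentralizerGroup hh z.2⟩ :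
        unitaryCentralizerGroup A h) ∈ Subgroup.center (unitaryCentralizerGroup A h) :=
  mem_center_unitaryCentralizerGroup_of_coe_mem_span_pullbackOne
    (coe_mem_span_pullbackOne_of_mem_center_hodgeGroupOne hz)

/-- **`Z(Hdg) ⊂ Z(G_div)` as subgroups of `GL(H¹(A(ℂ); ℂ))`** (`h ∈ B¹(A) ⊗ ℂ`): the image of the centre of
`Hg(A)(ℂ)|_{H¹}` is contained in the image of the centre of `S(A)(h)(ℂ)`.
[cite: MoonenZarhin1998WeilClasses, Remark (1) after Criterion (2) (chunk p0004) and §1 Lemma (1) (chunk p0002)] -/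
theorem map_center_hodgeGroupOne_le_map_center_unitaryCentralizerGroup (hh : h ∈ hodgeClassSpan A.dim A.X 1) :
    (Subgroup.center (hodgeGroupOne A.dim A.X)).map (hodgeGroupOne A.dim A.X).subtype ≤
      (Subgroup.center (unitaryCentralizerGroup A h)).map (unitaryCentralizerGroup A h).subtype := by
  rintro _ ⟨z, hz, rfl⟩
  exact Subgroup.mem_map.2 ⟨_, mem_center_unitaryCentralizerGroup_of_mem_center_hodgeGroupOne hh hz, rfl⟩

/-! ### §4 `Z(G_div(X)) = G_div(X)` iff `X` is of CM-type -/

/-- **For `A` of CM-type, `S(A)(h)(ℂ)` is commutative** (Milne 1999b Rem. 1.10: for `A` with many endomorphisms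
`C(A) = C₀(A) ⊗ Q` is commutative — the tree's `centralizerAlgebra_comm_of_isOfCMType` — and
`S(A)(h)(ℂ) ≤ (C(A) ⊗ ℂ)^×`); no hypothesis on `h`. [cite: Milne1999, §1 Rem. 1.10 (p. 53)]
[cite: Milne1999LefschetzClasses, §1 p. 644] -/
theorem unitaryCentralizerGroup_comm_of_isOfCMType (hA : IsOfCMType A)
    {u v : complexBetti A.X 1 ≃ₗ[ℂ] complexBetti A.X 1} (hu : u ∈ unitaryCentralizerGroup A h)
    (hv : v ∈ unitaryCentralizerGroup A h) : u * v = v * u := by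
  have e := centralizerAlgebra_comm_of_isOfCMType hA _
    (mem_centralizerGroup_iff_coe_mem.1 (unitaryCentralizerGroup_le_centralizerGroup hu)) _
    (mem_centralizerGroup_iff_coe_mem.1 (unitaryCentralizerGroup_le_centralizerGroup hv))
  refine LinearEquiv.ext fun x ↦ ?_
  have ex := LinearMap.congr_fun e x
  rw [Module.End.mul_apply, Module.End.mul_apply] at ex
  rw [LinearEquiv.mul_apply, LinearEquiv.mul_apply]
  exact ex

/-- **If `S(A)(h)(ℂ)` is commutative (`h ∈ B¹(A) ⊗ ℂ`) then `A` is of CM-type**: `Hg(A)(ℂ)|_{H¹} ≤ S(A)(h)(ℂ)`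
is then commutative, an element of `Hg(A)(ℂ)` is determined by its degree-one component (`hodgeGroup_ext_one`),
so `Hg(A)(ℂ)` is commutative and `A` is of CM-type (Deligne I §5 / Lange 7.2.6, the tree's
`isOfCMType_of_hodgeGroup_comm`). [cite: Deligne1982HodgeCycles, I §5 (Prop. 5.1 and the definition before it)]
[cite: Milne1999LefschetzClasses, §4 p. 660 (L(A) ⊃ Hg(A))] -/
theorem isOfCMType_of_unitaryCentralizerGroup_comm (hh : h ∈ hodgeClassSpan A.dim A.X 1)
    (hS : ∀ u ∈ unitaryCentralizerGroup A h, ∀ v ∈ unitaryCentralizerGroup A h, u * v = v * u) :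
    IsOfCMType A := by
  refine isOfCMType_of_hodgeGroup_comm fun g hg g' hg' ↦ ?_
  refine hodgeGroup_ext_one (mul_mem hg hg') (mul_mem hg' hg) ?_
  rw [Pi.mul_apply, Pi.mul_apply]
  exact hS _ (hodgeGroupOne_le_unitaryCentralizerGroup hh (mem_hodgeGroupOne_iff.2 ⟨g, hg, rfl⟩)) _
    (hodgeGroupOne_le_unitaryCentralizerGroup hh (mem_hodgeGroupOne_iff.2 ⟨g', hg', rfl⟩))

/-- **`S(A)(h)(ℂ)` (`⊆ G_div(X)(ℂ)`) is commutative iff `X` is of CM-type** (`h ∈ B¹(A) ⊗ ℂ`; Milne 1999b Rem. 1.10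
with Deligne I §5). [cite: Milne1999, §1 Rem. 1.10 (p. 53)] [cite: Deligne1982HodgeCycles, I §5] -/
theorem unitaryCentralizerGroup_comm_iff_isOfCMType (hh : h ∈ hodgeClassSpan A.dim A.X 1) :
    (∀ u ∈ unitaryCentralizerGroup A h, ∀ v ∈ unitaryCentralizerGroup A h, u * v = v * u) ↔ IsOfCMType A :=
  ⟨isOfCMType_of_unitaryCentralizerGroup_comm hh, fun hA _ hu _ hv ↦ unitaryCentralizerGroup_comm_of_isOfCMType hA hu hv⟩

/-- **`Z(G_div(X)) = G_div(X)` iff `X` is of CM-type** (`G_div` read as `S(A)(h)(ℂ)`, `h ∈ B¹(A) ⊗ ℂ`): the centre of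
`S(A)(h)(ℂ)` is the whole group exactly when `A` is of CM-type — the case «`Z(G_div) = U_E`» a torus equal to
`G_div` itself. [cite: MoonenZarhin1998WeilClasses, §1 Lemma (1) (chunk p0002)] [cite: Milne1999, §1 Rem. 1.10 (p. 53)]
[cite: Deligne1982HodgeCycles, I §5] -/
theorem center_unitaryCentralizerGroup_eq_top_iff_isOfCMType (hh : h ∈ hodgeClassSpan A.dim A.X 1) :
    Subgroup.center (unitaryCentralizerGroup A h) = ⊤ ↔ IsOfCMType A := by
  rw [← unitaryCentralizerGroup_comm_iff_isOfCMType hh, Subgroup.eq_top_iff']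
  constructor
  · intro hc u hu v hv
    have e := Subgroup.mem_center_iff.1 (hc ⟨v, hv⟩) ⟨u, hu⟩
    exact congrArg Subtype.val e
  · intro hS z
    exact Subgroup.mem_center_iff.2 fun u ↦ Subtype.ext (hS _ u.2 _ z.2)

end Literature.AlgebraicGeometry.HodgeTheory

end
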